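import Mathlib
import HarnessLib

/-!
# `NoHeavyLowerTail` (stmt-CriticalPhenomena-4575) — tie locus, part 1: multi-affine pushing on `[0,1]^ι`

Support file (prover `prim-hp-8`, technique "tie/glue-locus exclusion"; `--supports stmt-CriticalPhenomena-4575`).
No definitions, no named facts, no sorries.  Pure real analysis, no percolation.

`F, D x : (ι → unitInterval) → ℝ` (`x ∈ T`, a finite set of competitors) are affine in each single coordinate —
as every `prodBernoulli`-probability of a fixed event is, by the one-bond decomposition.  Feasible region
`K = {w | ∀ x ∈ T, 0 ≤ D x w}`; for the champion inequalities `D x w = μ_w(R_q) − μ_w(R_x)` and `K` = "`q` is a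
level-`j` champion".

* `exists_boundary_root`: finitely many affine functions of one real variable, nonnegative at `s₀ > 0`, one of them
  negative at `0` — at the largest root in `(0, s₀]` all are nonnegative and one vanishes.
* `exists_tie_of_neg`: if `F ≥ 0` at every feasible CORNER (`w ∈ {0,1}^ι`), every feasible `w` with `F w < 0` can
  be moved, changing only coordinates that are neither `0` nor `1`, to a feasible `w'` with `F w' < 0` at which some
  constraint is TIGHT (`D x w' = 0`).  `nonneg_of_corners_of_ties`: so `F ≥ 0` on corners and ties gives `F ≥ 0`
  on all of `K`.
* `exists_allCritical_of_neg`: every feasible violation can be moved (same sense) to a feasible violation at which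
  every fractional coordinate is CRITICAL: each of its two corner values makes some constraint negative.
Part 2 (`…TieLocusCorner`) evaluates `prodBernoulli` at corners; part 3 (`…TieLocus`) instantiates for XZ / CIL.
-/

namespace Summit.CriticalPhenomena.PercolationContinuityZ3.Theorems

namespace TieLocus

open scoped BigOperators

open scoped BigOperators

/-- **Boundary root.**  Finitely many affine functions `s ↦ a x + s * c x`, all nonnegative at `s₀ > 0`, at least one
negative at `0`: then at the largest root `α ∈ (0, s₀]` of the negative-at-zero ones, all of them are nonnegative and
one vanishes. [folklore] -/
theorem exists_boundary_root {X : Type*} (T : Finset X) (a c : X → ℝ) (s₀ : ℝ) (hs₀ : 0 < s₀)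
    (hpos : ∀ x ∈ T, 0 ≤ a x + s₀ * c x) (hneg : ∃ x ∈ T, a x < 0) :
    ∃ α : ℝ, 0 < α ∧ α ≤ s₀ ∧ (∀ x ∈ T, 0 ≤ a x + α * c x) ∧ ∃ x ∈ T, a x + α * c x = 0 := by
  classical
  set T' := T.filter fun x => a x < 0 with hT'
  have hT'ne : T'.Nonempty := by
    obtain ⟨x, hx, hax⟩ := hneg
    exact ⟨x, Finset.mem_filter.2 ⟨hx, hax⟩⟩
  -- for `x ∈ T'` the slope is positive
  have hc : ∀ x ∈ T', 0 < c x := by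
    intro x hx
    obtain ⟨hxT, hax⟩ := Finset.mem_filter.1 hx
    have h1 := hpos x hxT
    by_contra hcx
    push Not at hcx
    nlinarith
  obtain ⟨y, hyT', hmax⟩ := Finset.exists_max_image T' (fun x => -a x / c x) hT'ne
  obtain ⟨hyT, hay⟩ := Finset.mem_filter.1 hyT'
  have hcy := hc y hyT'
  refine ⟨-a y / c y, div_pos (by linarith) hcy, ?_, ?_, ⟨y, hyT, ?_⟩⟩
  · -- `α ≤ s₀`
    rw [div_le_iff₀ hcy]
    have := hpos y hyT
    linarith
  · intro x hxT
    by_cases hax : a x < 0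
    · have hxT' : x ∈ T' := Finset.mem_filter.2 ⟨hxT, hax⟩
      have hcx := hc x hxT'
      have hle : -a x / c x ≤ -a y / c y := hmax x hxT'
      -- `a x + α c x ≥ a x + (−a x / c x) c x = 0`
      have h0 : a x + (-a x / c x) * c x = 0 := by
        field_simp
        ring
      have hmono : (-a x / c x) * c x ≤ (-a y / c y) * c x :=
        mul_le_mul_of_nonneg_right hle hcx.le
      linarith
    · push Not at hax
      by_cases hcx : 0 ≤ c x
      · have : 0 ≤ (-a y / c y) * c x := mul_nonneg (div_pos (by linarith) hcy).le hcx
        linarith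
      · push Not at hcx
        -- decreasing: value at `α ≤ s₀` is at least the value at `s₀`
        have hαle : -a y / c y ≤ s₀ := by
          rw [div_le_iff₀ hcy]
          have := hpos y hyT
          linarith
        have := hpos x hxT
        nlinarith
  · field_simp
    ring

variable {ι : Type*} [Fintype ι] [DecidableEq ι] {X : Type*}

omit [Fintype ι] in
/-- Value of a coordinatewise-affine function on the segment through `w` in direction `e`. [folklore] -/
theorem affine_update (F : (ι → unitInterval) → ℝ)
    (hF : ∀ (w : ι → unitInterval) (e : ι), F w =
      (1 - (w e : ℝ)) * F (Function.update w e 0) + (w e : ℝ) * F (Function.update w e 1))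
    (w : ι → unitInterval) (e : ι) (s : unitInterval) :
    F (Function.update w e s) =
      (1 - (s : ℝ)) * F (Function.update w e 0) + (s : ℝ) * F (Function.update w e 1) := by
  have h := hF (Function.update w e s) e
  simp only [Function.update_self, Function.update_idem] at h
  exact h

/-- Number of fractional coordinates. -/
private theorem card_frac_update_lt (w : ι → unitInterval) (e : ι) (he : (w e : ℝ) ≠ 0 ∧ (w e : ℝ) ≠ 1)
    (t : unitInterval) (ht : (t : ℝ) = 0 ∨ (t : ℝ) = 1) :
    (Finset.univ.filter fun i => ((Function.update w e t i : unitInterval) : ℝ) ≠ 0 ∧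
        ((Function.update w e t i : unitInterval) : ℝ) ≠ 1).card <
      (Finset.univ.filter fun i => ((w i : unitInterval) : ℝ) ≠ 0 ∧ ((w i : unitInterval) : ℝ) ≠ 1).card := by
  apply Finset.card_lt_card
  rw [Finset.ssubset_iff_of_subset]
  · refine ⟨e, Finset.mem_filter.2 ⟨Finset.mem_univ _, he⟩, ?_⟩
    intro h
    have h' := (Finset.mem_filter.1 h).2
    simp only [Function.update_self] at h'
    rcases ht with ht | ht
    · exact h'.1 ht
    · exact h'.2 ht
  · intro i hi
    have hi' := (Finset.mem_filter.1 hi).2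
    refine Finset.mem_filter.2 ⟨Finset.mem_univ _, ?_⟩
    by_cases hie : i = e
    · subst hie
      simp only [Function.update_self] at hi'
      rcases ht with ht | ht
      · exact absurd ht hi'.1
      · exact absurd ht hi'.2
    · simpa [Function.update_of_ne hie] using hi'

/-- **Pushing a violation to the tie locus.**  `F` and the constraints `D x` (`x ∈ T`) are affine in each
coordinate of `w ∈ [0,1]^ι`; `F ≥ 0` at every feasible corner.  Then every feasible `w` (`∀ x, 0 ≤ D x w`) with
`F w < 0` can be moved — changing only coordinates of `w` that are neither `0` nor `1` — to a feasible `w'` with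
`F w' < 0` at which some constraint is TIGHT (`D x w' = 0`).  Proof: induction on the number of fractional
coordinates; along one coordinate everything is affine, so the violation persists up to the first point where a
constraint becomes tight, or up to the corner value if none does. [folklore] -/
theorem exists_tie_of_neg (T : Finset X) (F : (ι → unitInterval) → ℝ) (D : X → (ι → unitInterval) → ℝ)
    (hF : ∀ (w : ι → unitInterval) (e : ι), F w =
      (1 - (w e : ℝ)) * F (Function.update w e 0) + (w e : ℝ) * F (Function.update w e 1))
    (hD : ∀ x ∈ T, ∀ (w : ι → unitInterval) (e : ι), D x w =
      (1 - (w e : ℝ)) * D x (Function.update w e 0) + (w e : ℝ) * D x (Function.update w e 1))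
    (hcorner : ∀ w : ι → unitInterval, (∀ e, (w e : ℝ) = 0 ∨ (w e : ℝ) = 1) →
      (∀ x ∈ T, 0 ≤ D x w) → 0 ≤ F w)
    (w : ι → unitInterval) (hw : ∀ x ∈ T, 0 ≤ D x w) (hneg : F w < 0) :
    ∃ w' : ι → unitInterval, (∀ x ∈ T, 0 ≤ D x w') ∧ (∃ x ∈ T, D x w' = 0) ∧ F w' < 0 ∧
      ∀ e, ((w e : ℝ) = 0 ∨ (w e : ℝ) = 1) → w' e = w e := by
  -- strong induction on the number of fractional coordinates
  suffices H : ∀ (m : ℕ) (w : ι → unitInterval),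
      (Finset.univ.filter fun i => ((w i : unitInterval) : ℝ) ≠ 0 ∧ ((w i : unitInterval) : ℝ) ≠ 1).card = m →
      (∀ x ∈ T, 0 ≤ D x w) → F w < 0 →
      ∃ w' : ι → unitInterval, (∀ x ∈ T, 0 ≤ D x w') ∧ (∃ x ∈ T, D x w' = 0) ∧ F w' < 0 ∧
        ∀ e, ((w e : ℝ) = 0 ∨ (w e : ℝ) = 1) → w' e = w e from H _ w rfl hw hneg
  intro m
  induction m using Nat.strong_induction_on with
  | _ m ih =>
  intro w hm hw hneg
  by_cases hall : ∀ e, (w e : ℝ) = 0 ∨ (w e : ℝ) = 1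
  · exact absurd hneg (not_lt.2 (hcorner w hall hw))
  push Not at hall
  obtain ⟨e, he0, he1⟩ := hall
  set s₀ : ℝ := (w e : ℝ) with hs₀def
  have hs₀0 : 0 < s₀ := lt_of_le_of_ne (w e).2.1 (Ne.symm he0)
  have hs₀1 : s₀ < 1 := lt_of_le_of_ne (w e).2.2 he1
  set w0 := Function.update w e 0 with hw0def
  set w1 := Function.update w e 1 with hw1def
  -- values along the segment
  have hFseg : ∀ s : unitInterval, F (Function.update w e s) = (1 - (s : ℝ)) * F w0 + (s : ℝ) * F w1 :=
    fun s => affine_update F hF w e s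
  have hDseg : ∀ x ∈ T, ∀ s : unitInterval,
      D x (Function.update w e s) = (1 - (s : ℝ)) * D x w0 + (s : ℝ) * D x w1 :=
    fun x hx s => affine_update (D x) (hD x hx) w e s
  have hwself : Function.update w e (w e) = w := Function.update_eq_self e w
  have hFw : F w = (1 - s₀) * F w0 + s₀ * F w1 := by
    have := hFseg (w e); rwa [hwself] at this
  have hDw : ∀ x ∈ T, D x w = (1 - s₀) * D x w0 + s₀ * D x w1 := by
    intro x hx; have := hDseg x hx (w e); rwa [hwself] at this
  -- the support clause for a point of the segment
  have hsupp : ∀ s : unitInterval, ∀ i, ((w i : ℝ) = 0 ∨ (w i : ℝ) = 1) →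
      Function.update w e s i = w i := by
    intro s i hi
    have hie : i ≠ e := by
      rintro rfl
      rcases hi with hi | hi
      · exact he0 hi
      · exact he1 hi
    exact Function.update_of_ne hie _ _
  -- number of fractional coordinates drops at the corner values
  have hlt : ∀ t : unitInterval, ((t : ℝ) = 0 ∨ (t : ℝ) = 1) →
      (Finset.univ.filter fun i => ((Function.update w e t i : unitInterval) : ℝ) ≠ 0 ∧
        ((Function.update w e t i : unitInterval) : ℝ) ≠ 1).card < m := by
    intro t ht
    rw [← hm]
    exact card_frac_update_lt w e ⟨he0, he1⟩ t ht
  -- reduction to an endpoint `t ∈ {0,1}` that is feasible and violating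
  have endpoint : ∀ t : unitInterval, ((t : ℝ) = 0 ∨ (t : ℝ) = 1) →
      (∀ x ∈ T, 0 ≤ D x (Function.update w e t)) → F (Function.update w e t) < 0 →
      ∃ w' : ι → unitInterval, (∀ x ∈ T, 0 ≤ D x w') ∧ (∃ x ∈ T, D x w' = 0) ∧ F w' < 0 ∧
        ∀ i, ((w i : ℝ) = 0 ∨ (w i : ℝ) = 1) → w' i = w i := by
    intro t ht hfeas hviol
    obtain ⟨w', h1, h2, h3, h4⟩ := ih _ (hlt t ht) (Function.update w e t) rfl hfeas hviol
    refine ⟨w', h1, h2, h3, fun i hi => ?_⟩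
    rw [h4 i (by rw [hsupp t i hi]; exact hi), hsupp t i hi]
  by_cases ha : F w0 < 0
  · -- go down (towards `s = 0`): the violation persists on `[0, s₀]`
    by_cases hfeas0 : ∀ x ∈ T, 0 ≤ D x w0
    · exact endpoint 0 (Or.inl rfl) hfeas0 ha
    · push Not at hfeas0
      obtain ⟨x₁, hx₁T, hx₁⟩ := hfeas0
      obtain ⟨α, hα0, hαs, hfeas, htie⟩ := exists_boundary_root T (fun x => D x w0)
        (fun x => D x w1 - D x w0) s₀ hs₀0
        (fun x hx => by have := hw x hx; rw [hDw x hx] at this; linarith) ⟨x₁, hx₁T, hx₁⟩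
      have hα1 : α ≤ 1 := hαs.trans hs₀1.le
      refine ⟨Function.update w e ⟨α, hα0.le, hα1⟩, fun x hx => ?_, ?_, ?_, hsupp _⟩
      · rw [hDseg x hx]; have := hfeas x hx; simp only at this ⊢; linarith
      · obtain ⟨x, hxT, hx0⟩ := htie
        exact ⟨x, hxT, by rw [hDseg x hxT]; simp only at hx0 ⊢; linarith⟩
      · rw [hFseg]
        simp only
        by_cases hab : F w0 ≤ F w1
        · nlinarith
        · push Not at hab
          nlinarith
  · -- go up (towards `s = 1`): `F w0 ≥ 0` forces `F w1 < 0`, and the violation persists on `[s₀, 1]`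
    push Not at ha
    have hb : F w1 < 0 := by
      by_contra hb
      push Not at hb
      have : 0 ≤ (1 - s₀) * F w0 + s₀ * F w1 := by positivity
      linarith
    by_cases hfeas1 : ∀ x ∈ T, 0 ≤ D x w1
    · exact endpoint 1 (Or.inr rfl) hfeas1 hb
    · push Not at hfeas1
      obtain ⟨x₁, hx₁T, hx₁⟩ := hfeas1
      obtain ⟨α, hα0, hαs, hfeas, htie⟩ := exists_boundary_root T (fun x => D x w1)
        (fun x => D x w0 - D x w1) (1 - s₀) (by linarith)
        (fun x hx => by have := hw x hx; rw [hDw x hx] at this; linarith) ⟨x₁, hx₁T, hx₁⟩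
      -- the point `β = 1 - α ∈ [s₀, 1)`
      have hβ0 : 0 ≤ 1 - α := by linarith
      have hβ1 : 1 - α ≤ 1 := by linarith
      refine ⟨Function.update w e ⟨1 - α, hβ0, hβ1⟩, fun x hx => ?_, ?_, ?_, hsupp _⟩
      · rw [hDseg x hx]; have := hfeas x hx; simp only at this ⊢; linarith
      · obtain ⟨x, hxT, hx0⟩ := htie
        exact ⟨x, hxT, by rw [hDseg x hxT]; simp only at hx0 ⊢; linarith⟩
      · rw [hFseg]
        simp only
        nlinarith

/-- **`F ≥ 0` on corners and ties ⇒ `F ≥ 0` on the whole feasible region.** [folklore] -/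
theorem nonneg_of_corners_of_ties (T : Finset X) (F : (ι → unitInterval) → ℝ) (D : X → (ι → unitInterval) → ℝ)
    (hF : ∀ (w : ι → unitInterval) (e : ι), F w =
      (1 - (w e : ℝ)) * F (Function.update w e 0) + (w e : ℝ) * F (Function.update w e 1))
    (hD : ∀ x ∈ T, ∀ (w : ι → unitInterval) (e : ι), D x w =
      (1 - (w e : ℝ)) * D x (Function.update w e 0) + (w e : ℝ) * D x (Function.update w e 1))
    (hcorner : ∀ w : ι → unitInterval, (∀ e, (w e : ℝ) = 0 ∨ (w e : ℝ) = 1) →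
      (∀ x ∈ T, 0 ≤ D x w) → 0 ≤ F w)
    (htie : ∀ w : ι → unitInterval, (∀ x ∈ T, 0 ≤ D x w) → (∃ x ∈ T, D x w = 0) → 0 ≤ F w)
    (w : ι → unitInterval) (hw : ∀ x ∈ T, 0 ≤ D x w) : 0 ≤ F w := by
  by_contra h
  push Not at h
  obtain ⟨w', h1, h2, h3, -⟩ := exists_tie_of_neg T F D hF hD hcorner w hw h
  exact absurd h3 (not_lt.2 (htie w' h1 h2))

/-- **Pushing a violation to an all-critical point.**  Same setting as `exists_tie_of_neg`.  Every feasible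
violation can be moved — changing only fractional coordinates — to a feasible violation `w'` at which EVERY
fractional coordinate `e` is CRITICAL: setting it to `0` or setting it to `1` makes some constraint negative
(for the champion inequalities: deleting or gluing the edge dethrones the champion).  Proof: a non-critical
fractional coordinate can be pushed to one of its two corner values keeping feasibility and the violation.
[folklore] -/
theorem exists_allCritical_of_neg (T : Finset X) (F : (ι → unitInterval) → ℝ) (D : X → (ι → unitInterval) → ℝ)
    (hF : ∀ (w : ι → unitInterval) (e : ι), F w =
      (1 - (w e : ℝ)) * F (Function.update w e 0) + (w e : ℝ) * F (Function.update w e 1))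
    (w : ι → unitInterval) (hw : ∀ x ∈ T, 0 ≤ D x w) (hneg : F w < 0) :
    ∃ w' : ι → unitInterval, (∀ x ∈ T, 0 ≤ D x w') ∧ F w' < 0 ∧
      (∀ e, ((w e : ℝ) = 0 ∨ (w e : ℝ) = 1) → w' e = w e) ∧
      ∀ e, (w' e : ℝ) ≠ 0 ∧ (w' e : ℝ) ≠ 1 →
        (∃ x ∈ T, D x (Function.update w' e 0) < 0) ∨ (∃ x ∈ T, D x (Function.update w' e 1) < 0) := by
  suffices H : ∀ (m : ℕ) (w : ι → unitInterval),
      (Finset.univ.filter fun i => ((w i : unitInterval) : ℝ) ≠ 0 ∧ ((w i : unitInterval) : ℝ) ≠ 1).card = m →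
      (∀ x ∈ T, 0 ≤ D x w) → F w < 0 →
      ∃ w' : ι → unitInterval, (∀ x ∈ T, 0 ≤ D x w') ∧ F w' < 0 ∧
        (∀ e, ((w e : ℝ) = 0 ∨ (w e : ℝ) = 1) → w' e = w e) ∧
        ∀ e, (w' e : ℝ) ≠ 0 ∧ (w' e : ℝ) ≠ 1 →
          (∃ x ∈ T, D x (Function.update w' e 0) < 0) ∨ (∃ x ∈ T, D x (Function.update w' e 1) < 0) from
    H _ w rfl hw hneg
  intro m
  induction m using Nat.strong_induction_on with
  | _ m ih =>
  intro w hm hw hneg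
  by_cases hcrit : ∀ e, (w e : ℝ) ≠ 0 ∧ (w e : ℝ) ≠ 1 →
      (∃ x ∈ T, D x (Function.update w e 0) < 0) ∨ (∃ x ∈ T, D x (Function.update w e 1) < 0)
  · exact ⟨w, hw, hneg, fun _ _ => rfl, hcrit⟩
  push Not at hcrit
  obtain ⟨e, ⟨he0, he1⟩, hfeas0, hfeas1⟩ := hcrit
  have hlt : ∀ t : unitInterval, ((t : ℝ) = 0 ∨ (t : ℝ) = 1) →
      (Finset.univ.filter fun i => ((Function.update w e t i : unitInterval) : ℝ) ≠ 0 ∧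
        ((Function.update w e t i : unitInterval) : ℝ) ≠ 1).card < m := by
    intro t ht
    rw [← hm]
    exact card_frac_update_lt w e ⟨he0, he1⟩ t ht
  have hsupp : ∀ t : unitInterval, ∀ i, ((w i : ℝ) = 0 ∨ (w i : ℝ) = 1) →
      Function.update w e t i = w i := by
    intro t i hi
    have hie : i ≠ e := by
      rintro rfl
      rcases hi with hi | hi
      · exact he0 hi
      · exact he1 hi
    exact Function.update_of_ne hie _ _
  -- one of the two corner values keeps the violation
  have hsplit : F (Function.update w e 0) < 0 ∨ F (Function.update w e 1) < 0 := by
    by_contra h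
    push Not at h
    have h0 := (w e).2.1
    have h1 := (w e).2.2
    have := hF w e
    nlinarith [h.1, h.2]
  rcases hsplit with hv | hv
  · obtain ⟨w', h1, h2, h3, h4⟩ := ih _ (hlt 0 (Or.inl rfl)) (Function.update w e 0) rfl hfeas0 hv
    refine ⟨w', h1, h2, fun i hi => ?_, h4⟩
    rw [h3 i (by rw [hsupp 0 i hi]; exact hi), hsupp 0 i hi]
  · obtain ⟨w', h1, h2, h3, h4⟩ := ih _ (hlt 1 (Or.inr rfl)) (Function.update w e 1) rfl hfeas1 hv
    refine ⟨w', h1, h2, fun i hi => ?_, h4⟩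
    rw [h3 i (by rw [hsupp 1 i hi]; exact hi), hsupp 1 i hi]

end TieLocus

end Summit.CriticalPhenomena.PercolationContinuityZ3.Theorems
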